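import Summits.NavierStokesRegularity.NavierStokesRegularity.Theorems.CriticalCoherenceDoorStretching
import Summits.NavierStokesRegularity.NavierStokesRegularity.Theorems.CriticalCoherenceDoorGronwall
import Summits.NavierStokesRegularity.NavierStokesRegularity.Theorems.CriticalCoherenceDoorPower
import Summits.NavierStokesRegularity.NavierStokesRegularity.Theorems.CriticalCoherenceDoorContinuation
import HarnessLib

/-!
# CriticalCoherenceDoor — door S33 «CriticalCoherenceDoor» (nsreg-p1 ROUND-31 v1.1 b67bf06eac869b0d, texts
# `Theorems/CriticalCoherenceDoorDefs.lean` = `r31/Sketch33.lean` ae52fe0f17f630b4): the CLOSERS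

`CriticalCoherenceDoor` and its balance form `CriticalBalanceDoor` BY NAME, with NO named-fact hypothesis:
the ½-Hölder coherence of the vorticity DIRECTION demanded only on the scale-critical intense set
`{(T − t)|ω(x,t)| > ε₀}` (against the fixed region `{|ω(y,t)| > Ω}`), one universal `ε₀ < √3/4`, no rate
hypothesis anywhere, implies continuation past `T` in the tree's Sobolev class. Plates: T33
`twoThresholdStretching_holds` (ns-s30-p1), G33 `powerGronwallSlab_holds` (ns-s29-p2), A33
`enstrophyPowerBoundAssembly_holds` (nsreg-C26-p1), P2 `subcriticalEnstrophyContinuation_holds` (ns-sfl-p1),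
P0 texts (nsreg-C26-p1), through the Defs compositions `criticalCoherenceDoor_of_plates` / `criticalBalanceDoor_of`.

HONEST FRAME: S33 is a regularity CRITERION / necessary condition for blow-up (a coherent scale-critical
intense set costs nothing: no blow-up), TYPE-II-INCLUSIVE; it says WHERE direction incoherence must sit at
a hypothetical blow-up. Item 0056 `NoTypeII` is NOT assumed and NOT met; nothing here proves NS regularity.
-/

noncomputable section

set_option linter.dupNamespace false

namespace Summit.NavierStokesRegularity.NavierStokesRegularity.Theorems.CriticalCoherenceDoor

/-- **DOOR S33 «CriticalCoherenceDoor» BY NAME (unconditional).** For `ν > 0`, `0 ≤ t₀ < T`,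
`0 < ε₀ < √3/4`, `Ω > 0`, real `M`, a classical unforced Navier–Stokes solution on `[0, T)` with bounded
Sobolev seminorms below `T` whose vorticity directions are ½-Hölder coherent on the pairs
`(T − t)|ω(x,t)| > ε₀`, `|ω(y,t)| > Ω` continues in the Sobolev class past `T`. -/
theorem criticalCoherenceDoor_holds : CriticalCoherenceDoor :=
  criticalCoherenceDoor_of_plates twoThresholdStretching_holds powerGronwallSlab_holds
    enstrophyPowerBoundAssembly_holds subcriticalEnstrophyContinuation_holds

/-- **DOOR S33, BALANCE FORM BY NAME (unconditional, no constant):** if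
`(T − t)|ω(x,t)| · |ξ(x,t) ∧ ξ(y,t)| ≤ K |x − y|^{1/2}` for all late `t`, all `x`, and all `y` with
`|ω(y,t)| > Ω`, then no blow-up at `T`. -/
theorem criticalBalanceDoor_holds : CriticalBalanceDoor :=
  criticalBalanceDoor_of criticalCoherenceDoor_holds

end Summit.NavierStokesRegularity.NavierStokesRegularity.Theorems.CriticalCoherenceDoor

end
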